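import Mathlib

/-!
# The second moment of fixed-point counts ("twins ℓ²") — ensemble twin supply by Cauchy–Schwarz
# (crux `SnSubsetDichotomy.HyperoctahedralThreshold`, stmt-MatrixMultiplication-10883, refutation line
# `refutation_local_symmetry`, open core `stub_poorRigidCore`; siege k22, variation "twins ℓ² argument")

Three involutions `μ b` of `Fin n` act on the right, `x · g := g.foldl (fun v b => μ b v) x`.  A **based twin
pre-pair** of length `m` is `((x, y), w)`: `x ≠ y`, `w` reduced (`List.IsChain (· ≠ ·) w`) of length `m`, closing at
BOTH points (`x · w = x`, `y · w = y`) — a closed non-backtracking walk of the Schreier graph on ordered pairs off the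
diagonal (`Γ²_off`); their number is the second moment `Σ_w |Fix w| (|Fix w| - 1)` of the fixed-point counts.

`twinSecondMoment` (crux NOTES §12.3, the elementary substitute for Kotani–Sunada on `Γ²_off`): for every colour `c`,
  `((n² - n) 2^k)² ≤ (n² - n)² · ((n² - n) 2^k + Σ_{i<k} 3^i · TW(2k - 2i))`,
`TW(m)` := number of based twin pre-pairs with `w` of length `m` and first/last letter `≠ c`.  So once
`2^k ≥ 2 (n² - n) > 0`: `Σ_{i<k} 3^i TW(2k - 2i) ≥ 4^k / 2` — twin pre-pairs of length `≤ 2k ≈ 4 log₂ n + 3` with COUNTED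
multiplicity (the pointwise existence form (S2) is the sibling `…TwinSupply`, p112567; the same count for same-colour
reflection structures is `…StubSameColourSupply`, p112303, from which the generic lemmas below are copied — that module
post-dates the farm snapshot, so it cannot be imported yet).  Proof: `D` := (off-diagonal pairs) × (reduced words of
length `k`, head `≠ c`), `Φ (P, g) := (P, P · g)`; Cauchy–Schwarz over the `(n² - n)²` slots; an off-diagonal colliding
pair (same `P`, distinct words, equal action on both points) with longest common suffix of length `i < k` injects via
`(e₁, e₂) ↦ (suffix, (P, h₁ ++ h₂⁻¹))` into (words of length `i`) × `TW(2k - 2i)`.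
Pure finite combinatorics, no definitions.  NOT here: cyclic reduction of `w` (conjugation) and every DEFECT estimate.
-/

set_option linter.dupNamespace false

namespace Summit.MatrixMultiplication.MatrixMultiplication.Theorems.HyperoctahedralThreshold.TwinSecondMoment

open Finset

variable {n : ℕ}

/-! ### Generic lemmas — private copies, adapted from
Summits/…/SnSubsetDichotomyHyperoctahedralThresholdStubSameColourSupply.lean (p112303; not importable yet: that module
post-dates the farm snapshot — replace by `open …Supply` once it is built) -/

/-- Walking back along the reversed word undoes the walk (letters are involutions). -/
private theorem foldl_act_reverse (μ : Fin 3 → Equiv.Perm (Fin n)) (hμ : ∀ b, μ b * μ b = 1) :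
    ∀ (w : List (Fin 3)) (x : Fin n), w.reverse.foldl (fun v b => μ b v) (w.foldl (fun v b => μ b v) x) = x := by
  intro w
  induction w with
  | nil => intro x; rfl
  | cons c w ih =>
    intro x
    rw [List.foldl_cons, List.reverse_cons, List.foldl_append, ih]
    show μ c (μ c x) = x
    have : (μ c * μ c) x = x := by rw [hμ c]; rfl
    simpa using this

/-- The action of a fixed word is injective. -/
private theorem foldl_act_injective (μ : Fin 3 → Equiv.Perm (Fin n)) (hμ : ∀ b, μ b * μ b = 1)
    (w : List (Fin 3)) : Function.Injective (fun x => w.foldl (fun v b => μ b v) x) := by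
  intro x y h
  have := congrArg (fun v => w.reverse.foldl (fun v b => μ b v) v) h
  simpa [foldl_act_reverse μ hμ] using this

/-- Membership in the `Finset` of all words of length `m`. -/
private theorem mem_words {α : Type*} [Fintype α] [DecidableEq α] {m : ℕ} {z : List α} :
    z ∈ (Finset.univ : Finset (List.Vector α m)).image (fun v => v.toList) ↔ z.length = m := by
  constructor
  · intro h
    obtain ⟨v, -, rfl⟩ := Finset.mem_image.1 h
    exact v.toList_length
  · intro h
    exact Finset.mem_image.2 ⟨⟨z, h⟩, Finset.mem_univ _, rfl⟩

/-- There are `3 ^ m` colour words of length `m`. -/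
private theorem card_words (m : ℕ) :
    ((Finset.univ : Finset (List.Vector (Fin 3) m)).image (fun v => v.toList)).card = 3 ^ m := by
  rw [Finset.card_image_of_injective _ List.Vector.toList_injective, Finset.card_univ, card_vector,
    Fintype.card_fin]

/-- There are `2 ^ k` reduced colour words of length `k` whose first letter is not `c`. -/
private theorem card_redWords (k : ℕ) : ∀ c : Fin 3,
    (((Finset.univ : Finset (List.Vector (Fin 3) k)).image (fun v => v.toList)).filter
      (fun g => List.IsChain (· ≠ ·) g ∧ g.head? ≠ some c)).card = 2 ^ k := by
  induction k with
  | zero =>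
    intro c
    rw [pow_zero, Finset.card_eq_one]
    refine ⟨[], ?_⟩
    ext g
    simp only [Finset.mem_filter, mem_words, Finset.mem_singleton, List.length_eq_zero_iff]
    constructor
    · rintro ⟨rfl, -⟩; rfl
    · rintro rfl; simp
  | succ k ih =>
    intro c
    rw [Finset.card_eq_sum_card_fiberwise (f := fun g : List (Fin 3) => g.head?.getD c)
      (t := (Finset.univ : Finset (Fin 3)).filter (fun b => b ≠ c)) ?maps]
    case maps =>
      intro g hg
      obtain ⟨hlen, -, hhd⟩ := Finset.mem_filter.1 (Finset.mem_coe.1 hg)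
      rw [mem_words] at hlen
      obtain ⟨x, t, rfl⟩ := List.exists_cons_of_length_eq_add_one hlen
      simp only [List.head?_cons, Option.getD_some, Finset.coe_filter, Finset.mem_univ, true_and,
        Set.mem_setOf_eq]
      intro h; exact hhd (by rw [h]; rfl)
    have hfib : ∀ b ∈ (Finset.univ : Finset (Fin 3)).filter (fun b => b ≠ c),
        ((((Finset.univ : Finset (List.Vector (Fin 3) (k + 1))).image (fun v => v.toList)).filter
          (fun g => List.IsChain (· ≠ ·) g ∧ g.head? ≠ some c)).filter
            (fun g => g.head?.getD c = b)).card = 2 ^ k := by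
      intro b hb
      have hbc : b ≠ c := (Finset.mem_filter.1 hb).2
      rw [← ih b]
      refine Finset.card_nbij' (fun g => g.tail) (fun t => b :: t) ?_ ?_ ?_ ?_
      · intro g hg
        obtain ⟨hg1, hg2⟩ := Finset.mem_filter.1 (Finset.mem_coe.1 hg)
        obtain ⟨hlen, hch, -⟩ := Finset.mem_filter.1 hg1
        rw [mem_words] at hlen
        obtain ⟨x, t, rfl⟩ := List.exists_cons_of_length_eq_add_one hlen
        simp only [List.head?_cons, Option.getD_some] at hg2
        subst hg2
        refine Finset.mem_coe.2 (Finset.mem_filter.2 ⟨mem_words.2 (by simpa using hlen), hch.tail, ?_⟩)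
        intro ht
        exact (List.isChain_cons.1 hch).1 x ht rfl
      · intro t ht
        obtain ⟨hlen, hch, hhd⟩ := Finset.mem_filter.1 (Finset.mem_coe.1 ht)
        rw [mem_words] at hlen
        refine Finset.mem_coe.2 (Finset.mem_filter.2 ⟨Finset.mem_filter.2 ⟨mem_words.2 (by simp [hlen]),
          ?_, ?_⟩, by simp⟩)
        · refine List.isChain_cons.2 ⟨?_, hch⟩
          intro y hy hby
          exact hhd (by rw [hby]; exact (Option.mem_def.1 hy))
        · simpa using hbc
      · intro g hg
        obtain ⟨hg1, hg2⟩ := Finset.mem_filter.1 (Finset.mem_coe.1 hg)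
        obtain ⟨hlen, -, -⟩ := Finset.mem_filter.1 hg1
        rw [mem_words] at hlen
        obtain ⟨x, t, rfl⟩ := List.exists_cons_of_length_eq_add_one hlen
        simp only [List.head?_cons, Option.getD_some] at hg2
        subst hg2; rfl
      · intro t _; rfl
    rw [Finset.sum_congr rfl hfib, Finset.sum_const, smul_eq_mul, Finset.filter_ne',
      Finset.card_erase_of_mem (Finset.mem_univ c), Finset.card_univ, Fintype.card_fin, pow_succ]
    ring

/-- Cauchy–Schwarz for fibres: `|s| ^ 2 ≤ |t| · #{(x, y) ∈ s × s : f x = f y}` when `f` maps `s` into `t`. -/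
private theorem card_sq_le_card_mul_card_pairs {α β : Type*} [DecidableEq β] (s : Finset α) (t : Finset β)
    (f : α → β) (hf : ∀ x ∈ s, f x ∈ t) :
    s.card ^ 2 ≤ t.card * ((s ×ˢ s).filter (fun q => f q.1 = f q.2)).card := by
  have h1 : s.card = ∑ b ∈ t, (s.filter (fun x => f x = b)).card :=
    Finset.card_eq_sum_card_fiberwise (fun x hx => hf x hx)
  have h2 : ((s ×ˢ s).filter (fun q => f q.1 = f q.2)).card =
      ∑ b ∈ t, (s.filter (fun x => f x = b)).card ^ 2 := by
    rw [Finset.card_eq_sum_card_fiberwise (f := fun q : α × α => f q.1) (t := t) ?_]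
    · refine Finset.sum_congr rfl (fun b _ => ?_)
      rw [sq, ← Finset.card_product]
      congr 1
      ext q
      simp only [Finset.mem_filter, Finset.mem_product]
      constructor
      · rintro ⟨⟨⟨hq1, hq2⟩, hq3⟩, hq4⟩
        exact ⟨⟨hq1, hq4⟩, hq2, hq3.symm.trans hq4⟩
      · rintro ⟨⟨hq1, hq2⟩, hq3, hq4⟩
        exact ⟨⟨⟨hq1, hq3⟩, hq2.trans hq4.symm⟩, hq2⟩
    · intro q hq
      have hq' := Finset.mem_filter.1 (Finset.mem_coe.1 hq)
      exact Finset.mem_coe.2 (hf q.1 (Finset.mem_product.1 hq'.1).1)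
  rw [h2, h1]
  exact sq_sum_le_card_mul_sum_sq

/-- Discrete intermediate value: a predicate true at `0` and false at `k` steps down somewhere below `k`. -/
private theorem exists_step {P : ℕ → Prop} : ∀ k : ℕ, P 0 → ¬ P k → ∃ i < k, P i ∧ ¬ P (i + 1)
  | 0, h0, hk => absurd h0 hk
  | k + 1, h0, hk => by
    by_cases h : P k
    · exact ⟨k, Nat.lt_succ_self k, h, hk⟩
    · obtain ⟨i, hi, hP⟩ := exists_step k h0 h
      exact ⟨i, Nat.lt_succ_of_lt hi, hP⟩

/-! ### Suffix surgery on a colliding pair of words with the same start -/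

/-- From two reduced words `g₁, g₂` of length `k`, first letters `≠ c`, whose longest common suffix has length
`i < k`, the word `h₁ ++ h₂⁻¹` (`gⱼ = hⱼ ++ s`, `|s| = i`) is reduced of length `2k - 2i` with first and last
letter `≠ c` (the word part of `Supply.collision_structure`, p112303). -/
theorem collision_word (c : Fin 3) {k i : ℕ} (hi : i < k) {g₁ g₂ : List (Fin 3)}
    (hl₁ : g₁.length = k) (hl₂ : g₂.length = k)
    (hc₁ : List.IsChain (· ≠ ·) g₁) (hc₂ : List.IsChain (· ≠ ·) g₂)
    (hh₁ : g₁.head? ≠ some c) (hh₂ : g₂.head? ≠ some c)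
    (hs : g₁.drop (k - i) = g₂.drop (k - i))
    (hns : g₁.drop (k - (i + 1)) ≠ g₂.drop (k - (i + 1))) :
    (g₁.take (k - i) ++ (g₂.take (k - i)).reverse).length = 2 * k - 2 * i ∧
    List.IsChain (· ≠ ·) (g₁.take (k - i) ++ (g₂.take (k - i)).reverse) ∧
    (g₁.take (k - i) ++ (g₂.take (k - i)).reverse).head? ≠ some c ∧
    (g₁.take (k - i) ++ (g₂.take (k - i)).reverse).getLast? ≠ some c := by
  set h₁ := g₁.take (k - i) with hh1def
  set h₂ := g₂.take (k - i) with hh2def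
  set s := g₁.drop (k - i) with hsdef
  have hg₁ : g₁ = h₁ ++ s := (List.take_append_drop (k - i) g₁).symm
  have hg₂ : g₂ = h₂ ++ s := by rw [hs]; exact (List.take_append_drop (k - i) g₂).symm
  have hlh₁ : h₁.length = k - i := by rw [List.length_take]; omega
  have hlh₂ : h₂.length = k - i := by rw [List.length_take]; omega
  have hne₁ : h₁ ≠ [] := List.ne_nil_of_length_pos (by omega)
  have hne₂ : h₂ ≠ [] := List.ne_nil_of_length_pos (by omega)
  refine ⟨?_, ?_, ?_, ?_⟩
  · rw [List.length_append, List.length_reverse, hlh₁, hlh₂]; omega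
  · refine List.IsChain.append (hc₁.take _) ?_ ?_
    · rw [List.isChain_reverse]
      exact (hc₂.take _).imp (fun x y hxy => Ne.symm hxy)
    · intro x hx y hy hxy
      rw [List.head?_reverse] at hy
      subst hxy
      apply hns
      have e₁ : g₁ = h₁.dropLast ++ ([x] ++ s) := by
        rw [← List.append_assoc, List.dropLast_append_getLast? x hx]; exact hg₁
      have e₂ : g₂ = h₂.dropLast ++ ([x] ++ s) := by
        rw [← List.append_assoc, List.dropLast_append_getLast? x hy]; exact hg₂
      have d₁ : g₁.drop (k - (i + 1)) = [x] ++ s := by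
        rw [e₁]; exact List.drop_left' (by rw [List.length_dropLast, hlh₁]; omega)
      have d₂ : g₂.drop (k - (i + 1)) = [x] ++ s := by
        rw [e₂]; exact List.drop_left' (by rw [List.length_dropLast, hlh₂]; omega)
      rw [d₁, d₂]
  · rw [List.head?_append_of_ne_nil _ hne₁, hh1def, List.head?_take, if_neg (by omega)]
    exact hh₁
  · rw [List.getLast?_append_of_ne_nil _ (by simpa using hne₂), List.getLast?_reverse, hh2def,
      List.head?_take, if_neg (by omega)]
    exact hh₂

/-- If two words with a common suffix `g₁.drop (k - i) = g₂.drop (k - i)` act equally on a point `a`, then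
`h₁ ++ h₂⁻¹` closes at `a` (cancel the suffix by injectivity of the word action, walk back along `h₂`). -/
theorem collision_closes (μ : Fin 3 → Equiv.Perm (Fin n)) (hμ : ∀ b, μ b * μ b = 1)
    {k i : ℕ} {a : Fin n} {g₁ g₂ : List (Fin 3)}
    (he : g₁.foldl (fun v b => μ b v) a = g₂.foldl (fun v b => μ b v) a)
    (hs : g₁.drop (k - i) = g₂.drop (k - i)) :
    (g₁.take (k - i) ++ (g₂.take (k - i)).reverse).foldl (fun v b => μ b v) a = a := by
  have hg₁ : g₁ = g₁.take (k - i) ++ g₁.drop (k - i) := (List.take_append_drop (k - i) g₁).symm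
  have hg₂ : g₂ = g₂.take (k - i) ++ g₁.drop (k - i) := by
    rw [hs]; exact (List.take_append_drop (k - i) g₂).symm
  have hca : (g₁.take (k - i)).foldl (fun v b => μ b v) a = (g₂.take (k - i)).foldl (fun v b => μ b v) a := by
    rw [hg₁, hg₂, List.foldl_append, List.foldl_append] at he
    exact foldl_act_injective μ hμ _ he
  rw [List.foldl_append, hca, foldl_act_reverse μ hμ]

/-- A colliding pair is recovered from the surgery word `h₁ ++ h₂⁻¹` and the common suffix (p112303). -/
private theorem collision_inverse {k i : ℕ} (hi : i ≤ k) {g₁ g₂ : List (Fin 3)}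
    (hl₁ : g₁.length = k) (hl₂ : g₂.length = k) (hs : g₁.drop (k - i) = g₂.drop (k - i)) :
    (g₁.take (k - i) ++ (g₂.take (k - i)).reverse).take (k - i) ++ g₁.drop (k - i) = g₁ ∧
    ((g₁.take (k - i) ++ (g₂.take (k - i)).reverse).drop (k - i)).reverse ++ g₁.drop (k - i) = g₂ := by
  have hlh₁ : (g₁.take (k - i)).length = k - i := by rw [List.length_take]; omega
  constructor
  · rw [List.take_left' hlh₁]; exact List.take_append_drop _ _
  · rw [List.drop_left' hlh₁, List.reverse_reverse, hs]; exact List.take_append_drop _ _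

/-! ### Counting same-start collisions on ordered pairs -/

/-- Same-start collisions on off-diagonal ordered pairs whose longest common suffix has length exactly `i < k`
inject into (words of length `i`) × (based twin pre-pairs of length `2k - 2i`). -/
theorem card_twinCollisions_le (μ : Fin 3 → Equiv.Perm (Fin n)) (hμ : ∀ b, μ b * μ b = 1) (c : Fin 3)
    (k i : ℕ) (hi : i < k) :
    ((((((Finset.univ : Finset (Fin n)).offDiag) ×ˢ
        (((Finset.univ : Finset (List.Vector (Fin 3) k)).image (fun v => v.toList)).filter
          (fun g => List.IsChain (· ≠ ·) g ∧ g.head? ≠ some c))) ×ˢ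
       (((Finset.univ : Finset (Fin n)).offDiag) ×ˢ
        (((Finset.univ : Finset (List.Vector (Fin 3) k)).image (fun v => v.toList)).filter
          (fun g => List.IsChain (· ≠ ·) g ∧ g.head? ≠ some c)))).filter
      (fun q => q.1 ≠ q.2 ∧ q.1.1 = q.2.1 ∧
        q.1.2.foldl (fun v b => μ b v) q.1.1.1 = q.2.2.foldl (fun v b => μ b v) q.2.1.1 ∧
        q.1.2.foldl (fun v b => μ b v) q.1.1.2 = q.2.2.foldl (fun v b => μ b v) q.2.1.2)).filter
      (fun q => q.1.2.drop (k - i) = q.2.2.drop (k - i) ∧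
        q.1.2.drop (k - (i + 1)) ≠ q.2.2.drop (k - (i + 1)))).card ≤
    3 ^ i * ((((Finset.univ : Finset (Fin n)).offDiag) ×ˢ
      (((Finset.univ : Finset (List.Vector (Fin 3) (2 * k - 2 * i))).image (fun v => v.toList)).filter
        (fun g => List.IsChain (· ≠ ·) g ∧ g.head? ≠ some c ∧ g.getLast? ≠ some c))).filter
      (fun p => p.2.foldl (fun v b => μ b v) p.1.1 = p.1.1 ∧
        p.2.foldl (fun v b => μ b v) p.1.2 = p.1.2)).card := by
  rw [← card_words i, ← Finset.card_product]
  refine Finset.card_le_card_of_injOn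
    (fun q => (q.1.2.drop (k - i), (q.1.1, q.1.2.take (k - i) ++ (q.2.2.take (k - i)).reverse))) ?_ ?_
  · intro q hq
    rw [Finset.mem_coe, Finset.mem_filter, Finset.mem_filter, Finset.mem_product, Finset.mem_product,
      Finset.mem_product] at hq
    obtain ⟨⟨⟨⟨hP, hg₁⟩, -, hg₂⟩, -, hPP, he₁, he₂⟩, hs, hns⟩ := hq
    rw [Finset.mem_filter, mem_words] at hg₁ hg₂
    obtain ⟨hl₁, hc₁, hh₁⟩ := hg₁
    obtain ⟨hl₂, hc₂, hh₂⟩ := hg₂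
    obtain ⟨H1, H2, H3, H4⟩ := collision_word c hi hl₁ hl₂ hc₁ hc₂ hh₁ hh₂ hs hns
    rw [← hPP] at he₁ he₂
    have H5 := collision_closes μ hμ he₁ hs
    have H6 := collision_closes μ hμ he₂ hs
    rw [Finset.mem_coe, Finset.mem_product]
    refine ⟨mem_words.2 (by rw [List.length_drop, hl₁]; omega), ?_⟩
    rw [Finset.mem_filter, Finset.mem_product, Finset.mem_filter, mem_words]
    exact ⟨⟨hP, H1, H2, H3, H4⟩, H5, H6⟩
  · refine Set.LeftInvOn.injOn (f₁' := fun r => ((r.2.1, r.2.2.take (k - i) ++ r.1),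
      (r.2.1, (r.2.2.drop (k - i)).reverse ++ r.1))) ?_
    intro q hq
    rw [Finset.mem_coe, Finset.mem_filter, Finset.mem_filter, Finset.mem_product, Finset.mem_product,
      Finset.mem_product] at hq
    obtain ⟨⟨⟨⟨-, hg₁⟩, -, hg₂⟩, -, hPP, -, -⟩, hs, -⟩ := hq
    rw [Finset.mem_filter, mem_words] at hg₁ hg₂
    obtain ⟨hl₁, -, -⟩ := hg₁
    obtain ⟨hl₂, -, -⟩ := hg₂
    obtain ⟨E1, E2⟩ := collision_inverse hi.le hl₁ hl₂ hs
    rcases q with ⟨⟨P₁, w₁⟩, ⟨P₂, w₂⟩⟩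
    dsimp only at hPP E1 E2 ⊢
    rw [E1, E2, hPP]

/-! ### The second-moment inequality -/

/-- **Twin second moment (ensemble twin supply, crux NOTES §12.3).**  `D` := (ordered pairs of distinct points) ×
(reduced words of length `k`, head `≠ c`), `|D| = (n² - n) 2^k`; `Φ (P, g) := (P, P · g)` stays off-diagonal (words act
injectively); Cauchy–Schwarz: `|D|² ≤ (n² - n)² · (|D| + #collisions)`; a collision with longest common suffix of length `i`
is recovered from the suffix (`≤ 3^i` choices) and a based twin pre-pair of length `2k - 2i`. [folklore; crux NOTES §12.3] -/
theorem twinSecondMoment (n k : ℕ) (μ : Fin 3 → Equiv.Perm (Fin n)) (c : Fin 3)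
    (hμ : ∀ b, μ b * μ b = 1) :
    ((n * n - n) * 2 ^ k) ^ 2 ≤ ((n * n - n) * (n * n - n)) * ((n * n - n) * 2 ^ k +
      ∑ i ∈ Finset.range k, 3 ^ i *
      ((((Finset.univ : Finset (Fin n)).offDiag) ×ˢ
        (((Finset.univ : Finset (List.Vector (Fin 3) (2 * k - 2 * i))).image (fun v => v.toList)).filter
          (fun g => List.IsChain (· ≠ ·) g ∧ g.head? ≠ some c ∧ g.getLast? ≠ some c))).filter
        (fun p => p.2.foldl (fun v b => μ b v) p.1.1 = p.1.1 ∧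
          p.2.foldl (fun v b => μ b v) p.1.2 = p.1.2)).card) := by
  -- the domain `D` of the endpoint map
  set D := ((Finset.univ : Finset (Fin n)).offDiag) ×ˢ
    (((Finset.univ : Finset (List.Vector (Fin 3) k)).image (fun v => v.toList)).filter
      (fun g => List.IsChain (· ≠ ·) g ∧ g.head? ≠ some c)) with hD
  have hOD : ((Finset.univ : Finset (Fin n)).offDiag).card = n * n - n := by
    rw [Finset.offDiag_card, Finset.card_univ, Fintype.card_fin]
  have hDcard : D.card = (n * n - n) * 2 ^ k := by
    rw [hD, Finset.card_product, hOD, card_redWords k c]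
  -- the endpoint map `Φ (P, g) = (P, P·g)` lands in (off-diagonal)²
  set Φ : (Fin n × Fin n) × List (Fin 3) → (Fin n × Fin n) × (Fin n × Fin n) :=
    fun p => (p.1, (p.2.foldl (fun v b => μ b v) p.1.1, p.2.foldl (fun v b => μ b v) p.1.2)) with hΦ
  have hmaps : ∀ p ∈ D, Φ p ∈ ((Finset.univ : Finset (Fin n)).offDiag) ×ˢ
      ((Finset.univ : Finset (Fin n)).offDiag) := by
    intro p hp
    rw [hD, Finset.mem_product] at hp
    rw [Finset.mem_product]
    refine ⟨hp.1, ?_⟩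
    rw [Finset.mem_offDiag]
    refine ⟨Finset.mem_univ _, Finset.mem_univ _, ?_⟩
    intro h
    exact (Finset.mem_offDiag.1 hp.1).2.2 (foldl_act_injective μ hμ p.2 h)
  have hCS := card_sq_le_card_mul_card_pairs D _ Φ hmaps
  rw [hDcard, Finset.card_product, hOD] at hCS
  refine hCS.trans (Nat.mul_le_mul_left _ ?_)
  -- pairs with equal images are diagonal or collisions
  set C := (D ×ˢ D).filter (fun q => q.1 ≠ q.2 ∧ q.1.1 = q.2.1 ∧
    q.1.2.foldl (fun v b => μ b v) q.1.1.1 = q.2.2.foldl (fun v b => μ b v) q.2.1.1 ∧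
    q.1.2.foldl (fun v b => μ b v) q.1.1.2 = q.2.2.foldl (fun v b => μ b v) q.2.1.2) with hC
  have hF : (D ×ˢ D).filter (fun q => Φ q.1 = Φ q.2) ⊆ D.diag ∪ C := by
    intro q hq
    rw [Finset.mem_filter] at hq
    rw [Finset.mem_union, Finset.mem_diag]
    by_cases h : q.1 = q.2
    · exact Or.inl ⟨(Finset.mem_product.1 hq.1).1, h⟩
    · have h2 := hq.2
      simp only [hΦ, Prod.mk.injEq] at h2
      exact Or.inr (Finset.mem_filter.2 ⟨hq.1, h, h2.1, h2.2.1, h2.2.2⟩)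
  have hFcard : ((D ×ˢ D).filter (fun q => Φ q.1 = Φ q.2)).card ≤ (n * n - n) * 2 ^ k + C.card := by
    refine (Finset.card_le_card hF).trans ((Finset.card_union_le _ _).trans ?_)
    rw [Finset.diag_card, hDcard]
  refine hFcard.trans (Nat.add_le_add_left ?_ _)
  -- collisions, sorted by the length `i < k` of the longest common suffix
  have hcover : C ⊆ (Finset.range k).biUnion (fun i => C.filter (fun q =>
      q.1.2.drop (k - i) = q.2.2.drop (k - i) ∧ q.1.2.drop (k - (i + 1)) ≠ q.2.2.drop (k - (i + 1)))) := by
    intro q hq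
    have hq' := hq
    rw [hC, Finset.mem_filter, Finset.mem_product, hD, Finset.mem_product, Finset.mem_product] at hq'
    obtain ⟨⟨⟨-, hg₁⟩, -, hg₂⟩, hne, hPP, -, -⟩ := hq'
    rw [Finset.mem_filter, mem_words] at hg₁ hg₂
    obtain ⟨i, hik, hPi, hnP⟩ := exists_step (P := fun j => q.1.2.drop (k - j) = q.2.2.drop (k - j)) k
      (by
        rw [Nat.sub_zero, List.drop_of_length_le (by rw [hg₁.1]), List.drop_of_length_le (by rw [hg₂.1])])
      (by
        rw [Nat.sub_self, List.drop_zero, List.drop_zero]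
        intro hg
        exact hne (Prod.ext hPP hg))
    exact Finset.mem_biUnion.2 ⟨i, Finset.mem_range.2 hik, Finset.mem_filter.2 ⟨hq, hPi, hnP⟩⟩
  refine (Finset.card_le_card hcover).trans (Finset.card_biUnion_le.trans ?_)
  refine Finset.sum_le_sum (fun i hi => ?_)
  exact card_twinCollisions_le μ hμ c k i (Finset.mem_range.1 hi)

/-- **Registered form** (`stub_twinSecondMoment`, a `--supports` helper for the open core `stub_poorRigidCore` of
crux `stmt-MatrixMultiplication-10883`): the second-moment inequality `twinSecondMoment`, fully quantified. -/
theorem stub_twinSecondMoment : ∀ (n k : ℕ) (μ : Fin 3 → Equiv.Perm (Fin n)) (c : Fin 3), (∀ b, μ b * μ b = 1) → ((n * n - n) * 2 ^ k) ^ 2 ≤ ((n * n - n) * (n * n - n)) * ((n * n - n) * 2 ^ k + ∑ i ∈ Finset.range k, 3 ^ i * ((((Finset.univ : Finset (Fin n)).offDiag) ×ˢ (((Finset.univ : Finset (List.Vector (Fin 3) (2 * k - 2 * i))).image (fun v => v.toList)).filter (fun g => List.IsChain (· ≠ ·) g ∧ g.head? ≠ some c ∧ g.getLast? ≠ some c))).filter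 (fun p => p.2.foldl (fun v b => μ b v) p.1.1 = p.1.1 ∧ p.2.foldl (fun v b => μ b v) p.1.2 = p.1.2)).card) :=
  fun n k μ c hμ => twinSecondMoment n k μ c hμ

end Summit.MatrixMultiplication.MatrixMultiplication.Theorems.HyperoctahedralThreshold.TwinSecondMoment
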